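import Summits.Schanuel.Schanuel.Theorems.RootDecomp1ETwoScale08

/-!
# RootDecomp1ETwoScale — lens 2, generation 37 «TWO-SCALE E-PLANES» (items 25020 / 31409 of route 1E at n = 4 on `InTwoScaleClass`, mod NW96 Thm 1) — continuation (RootDecomp1ETwoScale09): §5b (v2, fact-free linear algebra over ℚ(i)) the first-failure binder of item 31409 at `z_TS` DISCHARGED: `linSub`, `bind_linSub_linSub`, `algebraicIndependent_linear_pair`, `rat_relation_of_colinear`, `algebraicIndependent_gauss_pair`, `ih_of_two_scales`, `zTS_ih`; `item31409_applied_at_zTS'` (the item the ONLY hypothesis), `item31409_instance_at_zTS' (hNW)`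

(lens-2 g37 `TwoScale.lean` v2 [HOME/decomp-schanuel-lens-2/g37/TwoScale.lean v2 sha256 e81e28b8…d084, 2853 l (v1 df3b5e32…, 2509 l + §5b); own farm rc 0 · 0 warn · 0 sorry · axioms std; critic VERDICT STATUS L1776 (credit E-R17, PORT GO), v2 ACK L1780]; port by census-1 gen 16 in nine parts
`RootDecomp1ETwoScale01`–`09` — see the PORT NOTE of part 01; `--supports stmt-Schanuel-31409`; rung 0.)
-/

noncomputable section

open Complex Polynomial IntermediateField Filter

namespace Summit.Schanuel.Schanuel.Theorems.RootDecomp1ETwoScale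

open Summit.Schanuel.Schanuel.Theorems.RootDecomp1KHyper
open Summit.Schanuel.Schanuel.Theorems.RootDecomp1KHyper.HyperCell
open Summit.Schanuel.Schanuel.Theorems.RootDecomp1KGeneric
open Literature.NumberTheory.Transcendental (NesterenkoWaldschmidt1996_thm_1 weilHeight₁)

variable {K : ℕ}

section Cells

open Summit.Schanuel.Schanuel.Theorems.RootDecomp1EPointTransfer (InPointClass OnHyperLine)
open Summit.Schanuel.Schanuel.Theorems.RootDecomp1EScaleTransfer (InScaleClass HyperScaleApprox)

/-- `k` algebraically independent members of an intermediate field give `trdeg ≥ k`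
(the three-line `RootDecomp1ELevels.le_trdeg_of_algebraicIndependent`, re-proved to keep the import cone small). -/
private theorem le_trdeg_of_algInd {L : IntermediateField ℚ ℂ} {k : ℕ} {v : Fin k → ℂ}
    (hv : AlgebraicIndependent ℚ v) (hmem : ∀ i, v i ∈ L) :
    (k : Cardinal) ≤ Algebra.trdeg ℚ ↥L := by
  let y : Fin k → ↥L := fun i => ⟨v i, hmem i⟩
  have hy : AlgebraicIndependent ℚ y := AlgebraicIndependent.of_comp L.val hv
  simpa using hy.cardinalMk_le_trdeg

/-- `i` is algebraic (`X² + 1`). -/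
private theorem isAlgebraic_I' : IsAlgebraic ℚ I :=
  ⟨X ^ 2 + 1, (Polynomial.monic_X_pow_add_C (1 : ℚ) two_ne_zero).ne_zero, by simp⟩

/-- A rational number is algebraic (as an element of `ℂ`). -/
private theorem ratCast_mem_acl (q : ℚ) : (q : ℂ) ∈ algebraicClosure ℚ ℂ :=
  (algebraicClosure ℚ ℂ).algebraMap_mem q

/-- `i` lies in the algebraic closure of `ℚ` in `ℂ`. -/
private theorem I_mem_acl : I ∈ algebraicClosure ℚ ℂ := mem_algebraicClosure_iff.mpr isAlgebraic_I'

/-! ### §5b  The first-failure binder of item 31409 at `z_TS` — DISCHARGED (fact-free linear algebra over `ℚ(i)`)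

The induction binder of `EStableDefectOne` at `z := z_TS`, `n := 4` asks `m ≤ trdeg ℚ(w, e^w) + 1` for every
ℚ-free `w` of length `m ≤ 3` inside `span_ℚ z_TS = ℚ(i)·T₀ ⊕ ℚ(i)·σ₀`.  It follows from the algebraic
independence of `(T₀, σ₀)` over `ℚ̄` ALONE (no exponential, no NW96): an invertible `ℚ(i)`-linear change of
variables preserves algebraic independence (`algebraicIndependent_linear_pair`, via `MvPolynomial.bind₁`),
and three ℚ-free vectors never fit on one `ℚ(i)`-line (`rat_relation_of_colinear`). -/

/-- The linear substitution `X₀ ↦ a X₀ + b X₁`, `X₁ ↦ c X₀ + d X₁`. -/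
def linSub {K : Type*} [Field K] (a b c d : K) : Fin 2 → MvPolynomial (Fin 2) K :=
  ![MvPolynomial.C a * MvPolynomial.X 0 + MvPolynomial.C b * MvPolynomial.X 1, MvPolynomial.C c * MvPolynomial.X 0 + MvPolynomial.C d * MvPolynomial.X 1]

/-- `linSub` on the first variable. -/
theorem linSub_zero {K : Type*} [Field K] (a b c d : K) :
    linSub a b c d 0 = MvPolynomial.C a * MvPolynomial.X 0 + MvPolynomial.C b * MvPolynomial.X 1 := rfl

/-- `linSub` on the second variable. -/
theorem linSub_one {K : Type*} [Field K] (a b c d : K) :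
    linSub a b c d 1 = MvPolynomial.C c * MvPolynomial.X 0 + MvPolynomial.C d * MvPolynomial.X 1 := rfl

/-- Composition of a substitution with its inverse is the identity. -/
theorem bind_linSub_linSub {K : Type*} [Field K] {a b c d a' b' c' d' : K}
    (h1 : a * a' + b * c' = 1) (h2 : a * b' + b * d' = 0) (h3 : c * a' + d * c' = 0)
    (h4 : c * b' + d * d' = 1) (p : MvPolynomial (Fin 2) K) :
    MvPolynomial.bind₁ (linSub a' b' c' d') (MvPolynomial.bind₁ (linSub a b c d) p) = p := by
  have hcomp : (MvPolynomial.bind₁ (linSub a' b' c' d')).comp (MvPolynomial.bind₁ (linSub a b c d)) =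
      AlgHom.id K (MvPolynomial (Fin 2) K) := by
    apply MvPolynomial.algHom_ext
    intro i
    have hC1 : (MvPolynomial.C a * MvPolynomial.C a' + MvPolynomial.C b * MvPolynomial.C c' : MvPolynomial (Fin 2) K) = 1 := by
      rw [← map_mul, ← map_mul, ← map_add, h1, map_one]
    have hC2 : (MvPolynomial.C a * MvPolynomial.C b' + MvPolynomial.C b * MvPolynomial.C d' : MvPolynomial (Fin 2) K) = 0 := by
      rw [← map_mul, ← map_mul, ← map_add, h2, map_zero]
    have hC3 : (MvPolynomial.C c * MvPolynomial.C a' + MvPolynomial.C d * MvPolynomial.C c' : MvPolynomial (Fin 2) K) = 0 := by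
      rw [← map_mul, ← map_mul, ← map_add, h3, map_zero]
    have hC4 : (MvPolynomial.C c * MvPolynomial.C b' + MvPolynomial.C d * MvPolynomial.C d' : MvPolynomial (Fin 2) K) = 1 := by
      rw [← map_mul, ← map_mul, ← map_add, h4, map_one]
    rw [AlgHom.comp_apply, AlgHom.id_apply, MvPolynomial.bind₁_X_right]
    fin_cases i
    · show MvPolynomial.bind₁ (linSub a' b' c' d') (MvPolynomial.C a * MvPolynomial.X 0 + MvPolynomial.C b * MvPolynomial.X 1) = MvPolynomial.X 0
      rw [map_add, map_mul, map_mul, MvPolynomial.bind₁_C_right, MvPolynomial.bind₁_C_right, MvPolynomial.bind₁_X_right, MvPolynomial.bind₁_X_right,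
        linSub_zero, linSub_one]
      linear_combination (MvPolynomial.X 0 : MvPolynomial (Fin 2) K) * hC1 + (MvPolynomial.X 1 : MvPolynomial (Fin 2) K) * hC2
    · show MvPolynomial.bind₁ (linSub a' b' c' d') (MvPolynomial.C c * MvPolynomial.X 0 + MvPolynomial.C d * MvPolynomial.X 1) = MvPolynomial.X 1
      rw [map_add, map_mul, map_mul, MvPolynomial.bind₁_C_right, MvPolynomial.bind₁_C_right, MvPolynomial.bind₁_X_right, MvPolynomial.bind₁_X_right,
        linSub_zero, linSub_one]
      linear_combination (MvPolynomial.X 0 : MvPolynomial (Fin 2) K) * hC3 + (MvPolynomial.X 1 : MvPolynomial (Fin 2) K) * hC4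
  have := DFunLike.congr_fun hcomp p
  simpa using this

/-- **Algebraic independence of a pair is invariant under an invertible linear change of variables.** -/
theorem algebraicIndependent_linear_pair {K : Type*} [Field K] [Algebra K ℂ] {x y : ℂ}
    (h : AlgebraicIndependent K ![x, y]) {a b c d : K} (hdet : a * d - b * c ≠ 0) :
    AlgebraicIndependent K ![a • x + b • y, c • x + d • y] := by
  classical
  set e : K := (a * d - b * c)⁻¹ with he
  have hee : (a * d - b * c) * e = 1 := by rw [he, mul_inv_cancel₀ hdet]
  have h1 : a * (d * e) + b * (-(c * e)) = 1 := by
    have : a * (d * e) + b * (-(c * e)) = (a * d - b * c) * e := by ring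
    rw [this, hee]
  have h2 : a * (-(b * e)) + b * (a * e) = 0 := by ring
  have h3 : c * (d * e) + d * (-(c * e)) = 0 := by ring
  have h4 : c * (-(b * e)) + d * (a * e) = 1 := by
    have : c * (-(b * e)) + d * (a * e) = (a * d - b * c) * e := by ring
    rw [this, hee]
  rw [algebraicIndependent_iff] at h ⊢
  intro p hp
  have hL : (fun i => MvPolynomial.aeval ![x, y] (linSub a b c d i)) = ![a • x + b • y, c • x + d • y] := by
    funext i
    fin_cases i
    · show MvPolynomial.aeval ![x, y] (linSub a b c d 0) = a • x + b • y
      rw [linSub_zero, map_add, map_mul, map_mul, MvPolynomial.aeval_C, MvPolynomial.aeval_C, MvPolynomial.aeval_X, MvPolynomial.aeval_X]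
      simp [Algebra.smul_def]
    · show MvPolynomial.aeval ![x, y] (linSub a b c d 1) = c • x + d • y
      rw [linSub_one, map_add, map_mul, map_mul, MvPolynomial.aeval_C, MvPolynomial.aeval_C, MvPolynomial.aeval_X, MvPolynomial.aeval_X]
      simp [Algebra.smul_def]
  have hq : MvPolynomial.aeval ![x, y] (MvPolynomial.bind₁ (linSub a b c d) p) = 0 := by rw [MvPolynomial.aeval_bind₁, hL, hp]
  have hq0 : MvPolynomial.bind₁ (linSub a b c d) p = 0 := h _ hq
  rw [← bind_linSub_linSub h1 h2 h3 h4 p, hq0, map_zero]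

/-- **Colinearity over `ℚ(i)` forces a ℚ-relation.**  If `(u + v i) w₁ = (x₁ + y₁ i) w₀` and
`(u + v i) w₂ = (x₂ + y₂ i) w₀` with rationals `u, v` not both zero, then `w₀, w₁, w₂` are ℚ-linearly
dependent (three vectors on the ℚ(i)-line through `w₀`, a plane over ℚ). -/
theorem rat_relation_of_colinear {w₀ w₁ w₂ : ℂ} {u v x₁ y₁ x₂ y₂ : ℚ} (huv : u ≠ 0 ∨ v ≠ 0)
    (h₁ : ((u : ℂ) + v * I) * w₁ = ((x₁ : ℂ) + y₁ * I) * w₀)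
    (h₂ : ((u : ℂ) + v * I) * w₂ = ((x₂ : ℂ) + y₂ * I) * w₀) :
    ∃ g₀ g₁ g₂ : ℚ, (g₀ ≠ 0 ∨ g₁ ≠ 0 ∨ g₂ ≠ 0) ∧ (g₀ : ℂ) * w₀ + g₁ * w₁ + g₂ * w₂ = 0 := by
  have hN : u ^ 2 + v ^ 2 ≠ 0 := by
    intro h0
    rcases huv with h | h
    · have := sq_pos_iff.mpr h; nlinarith [sq_nonneg v]
    · have := sq_pos_iff.mpr h; nlinarith [sq_nonneg u]
  -- clear the Gaussian denominator: N w_j = (P_j + Q_j i) w₀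
  have k₁ : ((u ^ 2 + v ^ 2 : ℚ) : ℂ) * w₁ =
      (((u * x₁ + v * y₁ : ℚ) : ℂ) + ((u * y₁ - v * x₁ : ℚ) : ℂ) * I) * w₀ := by
    push_cast
    linear_combination ((u : ℂ) - v * I) * h₁ + ((v : ℂ) ^ 2 * w₁ - v * y₁ * w₀) * Complex.I_mul_I
  have k₂ : ((u ^ 2 + v ^ 2 : ℚ) : ℂ) * w₂ =
      (((u * x₂ + v * y₂ : ℚ) : ℂ) + ((u * y₂ - v * x₂ : ℚ) : ℂ) * I) * w₀ := by
    push_cast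
    linear_combination ((u : ℂ) - v * I) * h₂ + ((v : ℂ) ^ 2 * w₂ - v * y₂ * w₀) * Complex.I_mul_I
  by_cases hQ : u * y₁ - v * x₁ = 0 ∧ u * y₂ - v * x₂ = 0
  · refine ⟨-(u * x₁ + v * y₁), u ^ 2 + v ^ 2, 0, Or.inr (Or.inl hN), ?_⟩
    rw [hQ.1] at k₁
    push_cast at k₁ ⊢
    linear_combination k₁
  · refine ⟨-((u * y₂ - v * x₂) * (u * x₁ + v * y₁) - (u * y₁ - v * x₁) * (u * x₂ + v * y₂)),
      (u * y₂ - v * x₂) * (u ^ 2 + v ^ 2), -((u * y₁ - v * x₁) * (u ^ 2 + v ^ 2)), ?_, ?_⟩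
    · rw [not_and_or] at hQ
      rcases hQ with h | h
      · exact Or.inr (Or.inr (neg_ne_zero.mpr (mul_ne_zero h hN)))
      · exact Or.inr (Or.inl (mul_ne_zero h hN))
    · push_cast at k₁ k₂ ⊢
      linear_combination ((u : ℂ) * y₂ - v * x₂) * k₁ - ((u : ℂ) * y₁ - v * x₁) * k₂

/-! ### Discharging the first-failure binder on a two-scale Gaussian plane -/

/-- Gaussian rationals lie in the algebraic closure of `ℚ` in `ℂ`. -/
private theorem gauss_mem_acl (p q : ℚ) : (p : ℂ) + q * I ∈ algebraicClosure ℚ ℂ :=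
  add_mem (ratCast_mem_acl p) (mul_mem (ratCast_mem_acl q) I_mem_acl)

/-- `n + 1 ≤ n + 1` bookkeeping (cardinal cast form). -/
private theorem succ_le_add_one' {k : ℕ} {t : Cardinal} (h : (k : Cardinal) ≤ t) :
    ((k + 1 : ℕ) : Cardinal) ≤ t + 1 := by
  rw [Nat.cast_succ]
  exact add_le_add h le_rfl

/-- **Gaussian-rational change of variables.**  If `(T, S)` is algebraically independent over the field
`ℚ̄ ∩ ℂ` of all algebraic numbers, then two `ℚ(i)`-combinations of `T, S` with non-vanishing determinant are
algebraically independent over ℚ. -/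
theorem algebraicIndependent_gauss_pair {T S : ℂ}
    (hK : AlgebraicIndependent (↥(algebraicClosure ℚ ℂ)) ![T, S]) (a₀ a₁ b₀ b₁ c₀ c₁ d₀ d₁ : ℚ)
    (hdet : ((a₀ : ℂ) + a₁ * I) * ((d₀ : ℂ) + d₁ * I) - ((b₀ : ℂ) + b₁ * I) * ((c₀ : ℂ) + c₁ * I) ≠ 0) :
    AlgebraicIndependent ℚ ![((a₀ : ℂ) + a₁ * I) * T + ((b₀ : ℂ) + b₁ * I) * S,
      ((c₀ : ℂ) + c₁ * I) * T + ((d₀ : ℂ) + d₁ * I) * S] := by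
  obtain ⟨a, ha⟩ : ∃ a : ↥(algebraicClosure ℚ ℂ), (a : ℂ) = (a₀ : ℂ) + a₁ * I :=
    ⟨⟨_, gauss_mem_acl a₀ a₁⟩, rfl⟩
  obtain ⟨b, hb⟩ : ∃ b : ↥(algebraicClosure ℚ ℂ), (b : ℂ) = (b₀ : ℂ) + b₁ * I :=
    ⟨⟨_, gauss_mem_acl b₀ b₁⟩, rfl⟩
  obtain ⟨c, hc⟩ : ∃ c : ↥(algebraicClosure ℚ ℂ), (c : ℂ) = (c₀ : ℂ) + c₁ * I :=
    ⟨⟨_, gauss_mem_acl c₀ c₁⟩, rfl⟩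
  obtain ⟨d, hd⟩ : ∃ d : ↥(algebraicClosure ℚ ℂ), (d : ℂ) = (d₀ : ℂ) + d₁ * I :=
    ⟨⟨_, gauss_mem_acl d₀ d₁⟩, rfl⟩
  have hdet' : a * d - b * c ≠ 0 := by
    intro h0
    apply hdet
    have h1 := congrArg Subtype.val h0
    push_cast at h1
    rw [ha, hb, hc, hd] at h1
    simpa using h1
  have h := (algebraicIndependent_linear_pair hK hdet').restrictScalars
    (algebraMap ℚ ↥(algebraicClosure ℚ ℂ)).injective
  have e : (![a • T + b • S, c • T + d • S] : Fin 2 → ℂ) =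
      ![((a₀ : ℂ) + a₁ * I) * T + ((b₀ : ℂ) + b₁ * I) * S,
        ((c₀ : ℂ) + c₁ * I) * T + ((d₀ : ℂ) + d₁ * I) * S] := by
    simp only [IntermediateField.smul_def, smul_eq_mul, ha, hb, hc, hd]
  rw [e] at h
  exact h

/-- Gaussian-rational coordinates of a vector in `span_ℚ (T, iT, S, iS)`. -/
theorem exists_gauss_coeffs {z : Fin 4 → ℂ} {T S : ℂ} (hz0 : z 0 = T) (hz1 : z 1 = I * T)
    (hz2 : z 2 = S) (hz3 : z 3 = I * S) {m : ℕ} {w : Fin m → ℂ}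
    (hmem : ∀ j, w j ∈ Submodule.span ℚ (Set.range z)) :
    ∃ c : Fin m → Fin 4 → ℚ,
      ∀ j, w j = ((c j 0 : ℂ) + c j 1 * I) * T + ((c j 2 : ℂ) + c j 3 * I) * S := by
  choose c hc using fun j => (Submodule.mem_span_range_iff_exists_fun ℚ).mp (hmem j)
  refine ⟨c, fun j => ?_⟩
  rw [← hc j, Fin.sum_univ_four, hz0, hz1, hz2, hz3]
  simp only [Rat.smul_def]
  ring

/-- **The first-failure binder of item 31409 on a two-scale Gaussian plane, from the algebraic
independence of the two scales over `ℚ̄` alone.**  For `z = (T, iT, S, iS)` with `(T, S)` algebraically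
independent over `algebraicClosure ℚ ℂ`: every ℚ-free `w` of length `m ≤ 3` inside `span_ℚ z` has
`m ≤ trdeg ℚ(w, e^w) + 1` — for `m = 3` two of the `w_j` are `ℚ(i)`-independent combinations of `T, S`
(three ℚ-free vectors do not fit on one `ℚ(i)`-line), hence algebraically independent. No exponential and
no transcendence fact is used. -/
theorem ih_of_two_scales {z : Fin 4 → ℂ} {T S : ℂ} (hz0 : z 0 = T) (hz1 : z 1 = I * T)
    (hz2 : z 2 = S) (hz3 : z 3 = I * S)
    (hK : AlgebraicIndependent (↥(algebraicClosure ℚ ℂ)) ![T, S]) :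
    ∀ (m : ℕ) (w : Fin m → ℂ), m < 4 → LinearIndependent ℚ w →
      (∀ j, w j ∈ Submodule.span ℚ (Set.range z)) →
      (m : Cardinal) ≤ Algebra.trdeg ℚ
        ↥(IntermediateField.adjoin ℚ (Set.range w ∪ Set.range (Complex.exp ∘ w))) + 1 := by
  intro m w hm hw hmem
  rcases (by omega : m = 0 ∨ m = 1 ∨ m = 2 ∨ m = 3) with rfl | rfl | rfl | rfl
  · rw [Nat.cast_zero]; exact zero_le
  · rw [Nat.cast_one]; exact le_add_self
  · -- `m = 2`: one transcendental coordinate suffices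
    obtain ⟨c, hwj⟩ := exists_gauss_coeffs hz0 hz1 hz2 hz3 hmem
    have memF : ∀ j, w j ∈ IntermediateField.adjoin ℚ (Set.range w ∪ Set.range (Complex.exp ∘ w)) :=
      fun j => IntermediateField.subset_adjoin ℚ _ (Set.mem_union_left _ ⟨j, rfl⟩)
    have hw0 : w 0 ≠ 0 := hw.ne_zero 0
    apply succ_le_add_one' (k := 1)
    by_cases hA : c 0 0 = 0 ∧ c 0 1 = 0
    · -- `A₀ = 0`, so `B₀ ≠ 0`: change of variables `(w₀, T)`
      have hB : (c 0 2 : ℂ) + c 0 3 * I ≠ 0 := by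
        intro hB0
        apply hw0
        rw [hwj 0, hA.1, hA.2, hB0]
        push_cast
        ring
      have h2 := algebraicIndependent_gauss_pair hK (c 0 0) (c 0 1) (c 0 2) (c 0 3) 1 0 0 0
        (by push_cast; intro h0; apply hB; linear_combination -h0)
      have h1 := h2.comp ![(0 : Fin 2)] (Function.injective_of_subsingleton _)
      refine le_trdeg_of_algInd h1 fun i => ?_
      fin_cases i
      show ((c 0 0 : ℂ) + c 0 1 * I) * T + ((c 0 2 : ℂ) + c 0 3 * I) * S ∈ _
      rw [← hwj 0]
      exact memF 0
    · -- `A₀ ≠ 0`: change of variables `(w₀, S)`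
      have hA' : (c 0 0 : ℂ) + c 0 1 * I ≠ 0 := by
        intro h0
        apply hA
        have h1 := congrArg Complex.re h0
        have h2 := congrArg Complex.im h0
        simp at h1 h2
        exact ⟨h1, h2⟩
      have h2 := algebraicIndependent_gauss_pair hK (c 0 0) (c 0 1) (c 0 2) (c 0 3) 0 0 1 0
        (by push_cast; intro h0; apply hA'; linear_combination h0)
      have h1 := h2.comp ![(0 : Fin 2)] (Function.injective_of_subsingleton _)
      refine le_trdeg_of_algInd h1 fun i => ?_
      fin_cases i
      show ((c 0 0 : ℂ) + c 0 1 * I) * T + ((c 0 2 : ℂ) + c 0 3 * I) * S ∈ _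
      rw [← hwj 0]
      exact memF 0
  · -- `m = 3`: two `ℚ(i)`-independent coordinates, or a ℚ-relation
    obtain ⟨c, hwj⟩ := exists_gauss_coeffs hz0 hz1 hz2 hz3 hmem
    have memF : ∀ j, w j ∈ IntermediateField.adjoin ℚ (Set.range w ∪ Set.range (Complex.exp ∘ w)) :=
      fun j => IntermediateField.subset_adjoin ℚ _ (Set.mem_union_left _ ⟨j, rfl⟩)
    have hw0 : w 0 ≠ 0 := hw.ne_zero 0
    -- no non-trivial ℚ-relation among `w 0, w 1, w 2`
    have norel : ∀ g₀ g₁ g₂ : ℚ, (g₀ ≠ 0 ∨ g₁ ≠ 0 ∨ g₂ ≠ 0) →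
        (g₀ : ℂ) * w 0 + g₁ * w 1 + g₂ * w 2 = 0 → False := by
      intro g₀ g₁ g₂ hg hrel
      have hsum : ∑ i, (![g₀, g₁, g₂] : Fin 3 → ℚ) i • w i = 0 := by
        rw [Fin.sum_univ_three]
        show g₀ • w 0 + g₁ • w 1 + g₂ • w 2 = 0
        simp only [Rat.smul_def]
        linear_combination hrel
      have hall := Fintype.linearIndependent_iff.mp hw _ hsum
      have e0 : g₀ = 0 := hall 0
      have e1 : g₁ = 0 := hall 1
      have e2 : g₂ = 0 := hall 2
      rcases hg with h | h | h
      · exact h e0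
      · exact h e1
      · exact h e2
    apply succ_le_add_one' (k := 2)
    -- abbreviations `A j = c_j0 + c_j1 i`, `B j = c_j2 + c_j3 i`
    obtain ⟨A, hA⟩ : ∃ A : Fin 3 → ℂ, ∀ j, A j = (c j 0 : ℂ) + c j 1 * I := ⟨_, fun _ => rfl⟩
    obtain ⟨B, hB⟩ : ∃ B : Fin 3 → ℂ, ∀ j, B j = (c j 2 : ℂ) + c j 3 * I := ⟨_, fun _ => rfl⟩
    have hwj' : ∀ j, w j = A j * T + B j * S := fun j => by rw [hA, hB]; exact hwj j
    -- a pair with non-vanishing minor is algebraically independent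
    have pair : ∀ j k, A j * B k - A k * B j ≠ 0 →
        ((2 : ℕ) : Cardinal) ≤ Algebra.trdeg ℚ
          ↥(IntermediateField.adjoin ℚ (Set.range w ∪ Set.range (Complex.exp ∘ w))) := by
      intro j k hjk
      have h2 := algebraicIndependent_gauss_pair hK (c j 0) (c j 1) (c j 2) (c j 3)
        (c k 0) (c k 1) (c k 2) (c k 3)
        (by rw [← hA j, ← hB j, ← hA k, ← hB k]; intro h0; apply hjk; linear_combination h0)
      rw [← hwj j, ← hwj k] at h2
      refine le_trdeg_of_algInd h2 fun i => ?_
      fin_cases i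
      · exact memF j
      · exact memF k
    by_cases h01 : A 0 * B 1 - A 1 * B 0 = 0
    · by_cases h02 : A 0 * B 2 - A 2 * B 0 = 0
      · -- degenerate: `w 1, w 2` on the `ℚ(i)`-line through `w 0` — contradicts ℚ-freeness
        exfalso
        by_cases hAz : c 0 0 = 0 ∧ c 0 1 = 0
        · -- `A 0 = 0`, use `B 0 ≠ 0`
          have hBz : c 0 2 ≠ 0 ∨ c 0 3 ≠ 0 := by
            by_contra hcon
            rw [not_or, not_not, not_not] at hcon
            apply hw0
            rw [hwj 0, hAz.1, hAz.2, hcon.1, hcon.2]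
            push_cast
            ring
          have k1 : B 0 * w 1 = B 1 * w 0 := by
            rw [hwj' 0, hwj' 1]; linear_combination (-T) * h01
          have k2 : B 0 * w 2 = B 2 * w 0 := by
            rw [hwj' 0, hwj' 2]; linear_combination (-T) * h02
          rw [hB 0, hB 1] at k1
          rw [hB 0, hB 2] at k2
          obtain ⟨g₀, g₁, g₂, hg, hrel⟩ := rat_relation_of_colinear hBz k1 k2
          exact norel g₀ g₁ g₂ hg hrel
        · have hAz' : c 0 0 ≠ 0 ∨ c 0 1 ≠ 0 := not_and_or.mp hAz
          have k1 : A 0 * w 1 = A 1 * w 0 := by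
            rw [hwj' 0, hwj' 1]; linear_combination S * h01
          have k2 : A 0 * w 2 = A 2 * w 0 := by
            rw [hwj' 0, hwj' 2]; linear_combination S * h02
          rw [hA 0, hA 1] at k1
          rw [hA 0, hA 2] at k2
          obtain ⟨g₀, g₁, g₂, hg, hrel⟩ := rat_relation_of_colinear hAz' k1 k2
          exact norel g₀ g₁ g₂ hg hrel
      · exact pair 0 2 h02
    · exact pair 0 1 h01

/-- **The first-failure binder of item 31409 at the member `z_TS`, DISCHARGED — hypothesis-free.** -/
theorem zTS_ih : ∀ (m : ℕ) (w : Fin m → ℂ), m < 4 → LinearIndependent ℚ w →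
    (∀ j, w j ∈ Submodule.span ℚ (Set.range zTS)) →
    (m : Cardinal) ≤ Algebra.trdeg ℚ ↥(IntermediateField.adjoin ℚ
      (Set.range w ∪ Set.range (Complex.exp ∘ w))) + 1 :=
  ih_of_two_scales (z := zTS) (T := (T₀ : ℂ)) (S := (σ₀ : ℂ)) rfl rfl rfl rfl
    algebraicIndependent_T₀σ₀.algebraicClosure

/-- **Item 31409 APPLIED at `z_TS` with ALL its scope binders discharged** (LI, E-stability, first failure):
the item is the only hypothesis. -/
theorem item31409_applied_at_zTS' (h31409 : Summit.Schanuel.Schanuel.Theses.RootDecomp1E.EStableDefectOne) :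
    ((4 : ℕ) : Cardinal) ≤ Algebra.trdeg ℚ ↥(IntermediateField.adjoin ℚ
        (Set.range zTS ∪ Set.range (Complex.exp ∘ zTS))) + 1 :=
  item31409_applied_at_zTS h31409 zTS_ih

/-- … and the same instance PROVED mod NW96 Thm 1 only (no carried binder). -/
theorem item31409_instance_at_zTS' (hNW : NesterenkoWaldschmidt1996_thm_1) :
    ((4 : ℕ) : Cardinal) ≤ Algebra.trdeg ℚ ↥(IntermediateField.adjoin ℚ
        (Set.range zTS ∪ Set.range (Complex.exp ∘ zTS))) + 1 :=
  item31409_instance_at_zTS hNW zTS_ih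

end Cells

end Summit.Schanuel.Schanuel.Theorems.RootDecomp1ETwoScale
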